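import Summits.MatrixMultiplication.OmegaCensus.STPPZoo313Checker

/-!
# ω-census (abelian STPP census): soundness pieces for the zoo checker — the depth-first generator is COMPLETE (kernel tool)

HONEST FRAMING (pub-omega census; verbatim): lottery ticket; floor = certified bounds/negative ranges.
Census STRUCTURE (seat pub-omega-stpp-1 gen 33, 2026-08-29), family (b2).  First soundness piece for `zooGo` (`STPPZoo313Checker.lean`): the generator
reaches EVERY admissible difference sequence.  `ZooValid S bb ds` mirrors the generator's constraints (each entry `1 ≤ d ≤` remaining budget minus the
number of later entries, at most `bb` entries `≥ 2`); `zooRun ds (bb, pos, mask, els)` is the state the generator carries to the leaf;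
`zooLeaf_of_zooGo`: if `zooGo p tbl ds.length S bb pos mask els = true` and `ZooValid S bb ds`, then `zooLeaf` holds at `zooRun ds (bb, pos, mask, els)`.
The remaining pieces (counter semantics; the identity `|{0,1,y} + Y| = 13 + r + #failures`; every normal-form `Y` has a `ZooValid` difference sequence)
are the successor's (HOME `pub-omega-stpp-1-g33/FIFTH-LEAF.md`).  No `decide`.  Nothing here is progress on `ω`.

References: H. Cohn, R. Kleinberg, B. Szegedy, C. Umans, FOCS 2005 (arXiv:math/0511460), Def. 5.1.
-/

namespace Summit.MatrixMultiplication.OmegaCensus.CubeNB.S2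

open Summit.MatrixMultiplication.OmegaCensus.CubeNB.Bits

/-- The generator's admissibility constraints on a difference sequence, from budget `S` with `bb` big entries allowed. [folklore] -/
def ZooValid : ℕ → ℕ → List ℕ → Prop
  | _, _, [] => True
  | S, bb, d :: ds => 1 ≤ d ∧ d ≤ S - ds.length ∧ (2 ≤ d → 1 ≤ bb) ∧ ZooValid (S - d) (if 2 ≤ d then bb - 1 else bb) ds

/-- The state `(bb, pos, mask, els)` carried by the generator along a difference sequence. [folklore] -/
def zooRun : List ℕ → ℕ × ℕ × ℕ × List ℕ → ℕ × ℕ × ℕ × List ℕ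
  | [], st => st
  | d :: ds, (bb, pos, mask, els) =>
    zooRun ds ((if 2 ≤ d then bb - 1 else bb), pos + d, mask ||| (1 <<< (pos + d)), (pos + d) :: els)

/-- **The generator is complete**: a `true` verdict of `zooGo` over `ds.length` remaining entries implies the leaf verdict at the state reached along any
admissible `ds`. [folklore] -/
theorem zooLeaf_of_zooGo (p : ℕ) (tbl : List (ℕ × ℕ)) :
    ∀ (ds : List ℕ) (S bb pos mask : ℕ) (els : List ℕ), ZooValid S bb ds →
      zooGo p tbl ds.length S bb pos mask els = true →
      zooLeaf p tbl (zooRun ds (bb, pos, mask, els)).1 (zooRun ds (bb, pos, mask, els)).2.2.1 (zooRun ds (bb, pos, mask, els)).2.2.2 = true := by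
  intro ds
  induction ds with
  | nil =>
    intro S bb pos mask els _ h
    simpa [zooGo, zooRun] using h
  | cons d ds ih =>
    intro S bb pos mask els hv h
    obtain ⟨h1, h2, h3, hv'⟩ := hv
    rw [List.length_cons, zooGo, List.all_eq_true] at h
    have hd : d ∈ List.range' 1 (S - ds.length) := by
      rw [List.mem_range'_1]; omega
    have hstep := h d hd
    by_cases hbig : 2 ≤ d
    · have hble : Nat.ble 2 d = true := Nat.ble_eq_true_of_le hbig
      rw [hble, cond_true, Bool.or_eq_true] at hstep
      have hbb : 1 ≤ bb := h3 hbig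
      rcases hstep with hz | hrec
      · exact absurd (Nat.eq_of_beq_eq_true hz) (by omega)
      · have := ih (S - d) (bb - 1) (pos + d) (mask ||| (1 <<< (pos + d))) ((pos + d) :: els) (by simpa [hbig] using hv') hrec
        simpa [zooRun, hbig] using this
    · have hble : Nat.ble 2 d = false := by
        cases hq : Nat.ble 2 d
        · rfl
        · exact absurd (Nat.le_of_ble_eq_true hq) hbig
      rw [hble, cond_false] at hstep
      have := ih (S - d) bb (pos + d) (mask ||| (1 <<< (pos + d))) ((pos + d) :: els) (by simpa [hbig] using hv') hstep
      simpa [zooRun, hbig] using this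

end Summit.MatrixMultiplication.OmegaCensus.CubeNB.S2
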